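import Summits.BirchSwinnertonDyer.BirchSwinnertonDyer.Theorems.PrintX9KatoLambdaMatch
import HarnessLib

/-!
# The `λ`-MATCH road at ANY odd good ordinary prime with irreducible NON-surjective image, class-free,
# and its reading on class X10b (`p = 3`): Kato's RATIONAL divisibility + `μ = 0` at the pair +
# `λ_an ≤ λ_alg` ⟹ Mazur's INTEGRAL main conjecture at the pair; ONE coefficient of `L_p` (the rank-0
# UNIT cell `‖L_p(0)‖ = 1`, the rank-1 cell `‖[T¹]L_p‖ = 1`) ⟹ Miller's `BSD(E,p)` modulo F1
# (print cell `bsd-print-x9`, seat p3; theorems only, nothing booked)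

Companion of `Theorems/PrintX9KatoLambdaMatch.lean` (same seat), whose core
`X9.mazurMainConjecture_of_kato_of_mu_eq_zero_of_order_le` reads the period unit off class X9
(`p ≥ 5`, `realPeriodRat_eq_unit_mul_plusPeriod`). Here the SAME Greenberg–Vatsal `λ`-argument is
stated CLASS-FREE at an odd good ordinary prime `p` with `E[p]` irreducible, the period unit entering as
the displayed hypothesis `hϖ : ord_p(Ω⁺_f/Ω_E) = 0` (as in the X10 lane's `X10.MuZeroRoad`), so that it
serves BOTH leaves of the cell: X9 (`p ∈ {5,7}`, `hϖ` from `realPeriodRat_eq_unit_mul_plusPeriod`) and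
X10b (`p = 3`, `hϖ` from `realPeriodRat_eq_unit_mul_plusPeriod_three`, tree lemma
`X10.padicValRat_periodRatio_eq_zero_three`).

§1 `OddPrime.mazurMainConjecture_of_kato_of_mu_eq_zero_of_order_le` — Kato Thm. 17.4 (2) at the pair
(`kato_divisibility`, clause 2; NO image hypothesis) + `μ(X(E/ℚ_∞)) = 0` at the pair + one unit
coefficient of `L_p(f, α)` + the one-sided `λ`-match `ord_T(G mod p) ≤ ord_T(f_E mod p)` ⟹
`MazurMainConjecture W p`; `OddPrime.order_le_of_rankOne_of_norm_coeff_one_eq_one` — the rank-1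
discharger (`‖[T¹]L_p‖ = 1`, Perrin-Riou–Schneider clause 1, GZK) at any odd `p` (the rank-0 discharger
`X9.order_le_of_norm_constantCoeff_eq_one` of the companion file is already class-free).
§2 Class X10b = `ClassX10 W p ∧ ¬ Surj W 3` (`p = 3` good ordinary, `E[3]` irreducible, `ρ̄_{E,3}` a
Cartan normaliser — the leaf `X10.BSDpOnClassX10b`'s hypotheses verbatim), modulo F1
(`X10.kato_divisibility_three_of_fine`, `X10.mu_eq_zero_of_fine`): `X10b.mazurMainConjecture_of_fine_of_norm_constantCoeff_eq_one`
/ `X10b.bsdp_of_fine_of_norm_constantCoeff_eq_one` (rank-0 UNIT cell: F1 + Greenberg Thm. 4.1 +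
modularity + GZK + period unit at `3` + ONE coefficient ⟹ X_A3 at the pair AND `BSD(E,3)` — compare the
X10 lane's UNIT ROAD `X10.UnitRoad.mazurMainConjecture_three_…_of_trivialArithmetic`, which needs the
`3`-DESCENT datum `#Sel_{3^∞}(E/ℚ) = 1`, `3 ∤ ∏ c_ℓ` and `L(E,1)/Ω_E` a unit as INPUTS: here the Selmer
and Tamagawa data are OUTPUTS of the main conjecture, the input is one coefficient), and
`X10b.mazurMainConjecture_rankOne_of_fine_of_norm_coeff_one_eq_one` /
`X10b.bsdp_rankOne_of_fine_of_norm_coeff_one_eq_one` (rank 1: F1 + Perrin-Riou–Schneider + Perrin-Riou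
1987 + modularity + GZK + period unit + ONE coefficient; the Schneider certificate is read off the same
coefficient).

Currency: PER PAIR; LITERAL while F1 (`Kato2004.exists_divisibilityInputs_fineQuotient_zeta`, aside
19843) carries its registry tokens. No rational main conjecture (no Yan–Zhu flag), no `#Ш_an` datum, no
descent datum, no image hypothesis beyond `¬ Surj`. Not a class theorem (`BSDpOnClassX10b` needs the
class-wide analytic `μ = 0`, `AnalyticMuZeroOnClassX10b`). Beyond print: "`3` good ordinary, `E[3]`
irreducible non-surjective, `L_3(E,0) ∈ ℤ_3^×` ⇒ `char_Λ X = Λ` and BSD_3" is not printed (Kato 17.4 (3)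
needs `3`-adic surjectivity; Greenberg's Prop. 3.8 / Thm. 4.1 need `Sel_3(E/ℚ) = 0` as input).

References: [Kato2004Asterisque] Thm. 12.5, 12.6, 17.4 (2), §17.13; [GreenbergVatsal2000] (1)–(2),
Prop. 3.7, Rem. 3.4, p. 20; [GreenbergLNM1716] Thm. 4.1; [PerrinRiou1987] §1.4 Cor. 1.8;
[BalakrishnanMullerStein2015] Thm. 1.7; [MazurSteinTate2006] Thm. 1.3; [Mazur1978] Cor. 4.1;
[Miller2011LMS] Def. 1.1; cell `bsd-smallim` KOLY-MEMO §5.7; X10 lane X10-AUDIT §40–§47.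
-/

set_option linter.dupNamespace false
set_option autoImplicit false

noncomputable section

open scoped Classical MatrixGroups ModularForm

open CongruenceSubgroup WeierstrassCurve Literature.NumberTheory.EllipticCurves
  Literature.NumberTheory.EllipticCurves.ModularForms Literature.NumberTheory.EllipticCurves.Rank1Residual
  Literature.NumberTheory.EllipticCurves.Rank1Residual.Typed
  Literature.NumberTheory.EllipticCurves.Wuthrich2014
  Literature.NumberTheory.EllipticCurves.Kato2004
  Summit.BirchSwinnertonDyer.BirchSwinnertonDyer.Theorems.Rank1ResidualX1Defs

namespace Summit.BirchSwinnertonDyer.BirchSwinnertonDyer.Rank1Residual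

variable (W : WeierstrassCurve ℚ) [W.IsElliptic] [W.IsGloballyMinimal] (p : ℕ) [Fact p.Prime]

/-! ### §1. Class-free, odd good ordinary `p`, `E[p]` irreducible -/

/-- **Odd good ordinary `p`, `E[p]` irreducible (ANY image), per pair: Kato Thm. 17.4 (2) + `μ = 0` at
the pair + one unit coefficient of `L_p` + the one-sided `λ`-match ⟹ Mazur's INTEGRAL cyclotomic main
conjecture at the pair** (`MazurMainConjecture W p`). Hypotheses: `hϖ` (the period unit `ord_p ϖ = 0` for
`ϖ · Ω_E = Ω⁺_f`, displayed); `hK` = `kato_divisibility` at the pair (clause (2) only); `hμ`; `hcert`;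
`hlam : ord_T(G mod p) ≤ ord_T(f_E mod p)` for a generator `f_E` of `char_Λ X` and the integral `G` with
`ι G = L_p(f, α)`. Proof: `f_E · h' = G` in `Λ` (the prime `p` of the UFD `Λ` divides Kato's cofactor
`n` times, `p ∤ f_E`), then Greenberg–Vatsal's `isUnit_of_mul_eq_of_order_map_eq`. The class-free form of
`X9.mazurMainConjecture_of_kato_of_mu_eq_zero_of_order_le`.
[cite: Kato2004Asterisque, Thm. 17.4 (2) (p. 273)] [cite: GreenbergVatsal2000, p. 2 (1)–(2), Prop. (3.7) and p. 20]
[cite: Washington1997, §13.1] -/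
theorem OddPrime.mazurMainConjecture_of_kato_of_mu_eq_zero_of_order_le (hp2 : p ≠ 2)
    (hgood : W.HasGoodReductionAtPrime p) (hord : ¬ (p : ℤ) ∣ W.frobeniusTrace p)
    (hirr : W.HasIrreducibleModPGaloisRep p)
    (hϖ : ∀ [NeZero (W.conductorNorm ℤ)] (f : CuspForm (Gamma0 (W.conductorNorm ℤ)) 2),
      IsNewformOf W f → ∀ ϖ : ℚ, (ϖ : ℝ) * W.realPeriodRat = plusPeriod f → padicValRat p ϖ = 0)
    (hK : ∀ (κ : ZpExtension ℚ p) (γ : Field.absoluteGaloisGroup ℚ) [NeZero (W.conductorNorm ℤ)]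
      (f : CuspForm (Gamma0 (W.conductorNorm ℤ)) 2), kato_divisibility W p (κ := κ) (γ := γ) (f := f))
    (hμ : ∀ (κ : ZpExtension ℚ p) (γ : Field.absoluteGaloisGroup ℚ),
        κ.IsCyclotomic → κ.IsTopGenerator γ → IsCyclotomicVariable p γ →
      ∀ (D : W.SelmerDualData κ γ), D.mu = 0)
    (hcert : ∀ [NeZero (W.conductorNorm ℤ)] (f : CuspForm (Gamma0 (W.conductorNorm ℤ)) 2),
      IsNewformOf W f → ∃ n : ℕ, ‖PowerSeries.coeff n (padicLFunction f (unitRoot W p : ℚ_[p]))‖ = 1)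
    (hlam : ∀ (κ : ZpExtension ℚ p) (γ : Field.absoluteGaloisGroup ℚ),
        κ.IsCyclotomic → κ.IsTopGenerator γ → IsCyclotomicVariable p γ →
      ∀ [NeZero (W.conductorNorm ℤ)] (f : CuspForm (Gamma0 (W.conductorNorm ℤ)) 2), IsNewformOf W f →
      ∀ (D : W.SelmerDualData κ γ) (fE G : IwasawaAlgebra p), D.charIdeal = Ideal.span {fE} →
        iwasawaToPowerSeries p G = padicLFunction f (unitRoot W p : ℚ_[p]) →
        (PowerSeries.map (PadicInt.toZMod (p := p)) G).order ≤
          (PowerSeries.map (PadicInt.toZMod (p := p)) fE).order) :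
    MazurMainConjecture W p := by
  intro κ γ hκ hγ hγ' _ f hf ϖ hϖeq D
  have hordp : IsOrdinaryAt W p := ⟨hgood, hord⟩
  -- the period ratio `ϖ` is a `p`-adic unit
  have hplus : plusPeriod f ≠ 0 := (IsNewform0.plusPeriod_pos_holds hf.1 hf.coeffField_eq_bot).ne'
  have hϖ0 : ϖ ≠ 0 := by
    rintro rfl
    apply hplus
    rw [← hϖeq]
    simp
  have hϖv : padicValRat p ϖ = 0 := hϖ f hf ϖ hϖeq
  have hϖn : ‖(ϖ : ℚ_[p])‖ = 1 := by
    rw [Padic.eq_padicNorm, padicNorm.eq_zpow_of_nonzero hϖ0, hϖv, neg_zero, zpow_zero, Rat.cast_one]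
  -- Kato (2): torsion and `ι g₀ = p^n · L_p` with `g₀ ∈ char X`
  obtain ⟨hX, ⟨n, g₀, hg₀, hι₀⟩, -⟩ := hK κ γ f hp2 hordp hκ hγ hγ' hf D
  haveI : Module.Finite (IwasawaAlgebra p) D.X := D.module_finite_holds hγ
  haveI : (Module.charIdeal (IwasawaAlgebra p) D.X).IsPrincipal := charIdeal_isPrincipal_holds p D.X
  obtain ⟨fE, hchar⟩ := Submodule.IsPrincipal.principal (Module.charIdeal (IwasawaAlgebra p) D.X)
  have hchar' : D.charIdeal = Ideal.span {fE} := hchar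
  -- `μ = 0`: `p ∤ fE`
  have hfE : GreenbergVatsal2000.HasUnitContent fE :=
    (GreenbergVatsal2000.mu_eq_zero_iff_hasUnitContent D hX hchar').mp (hμ κ γ hκ hγ hγ' D)
  have hndvd : ¬ (PowerSeries.C (p : ℤ_[p]) : IwasawaAlgebra p) ∣ fE :=
    (GreenbergVatsal2000.hasUnitContent_iff_not_C_dvd fE).mp hfE
  obtain ⟨h, hgh⟩ := Ideal.mem_span_singleton'.mp (hchar' ▸ hg₀ : g₀ ∈ Ideal.span {fE})
  -- `L_p = ι G`, `G ∈ Λ` (irreducibility)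
  obtain ⟨G, hG⟩ := exists_iwasawaToPowerSeries_eq_padicLFunction hp2 hordp hf hirr
  have hιC : iwasawaToPowerSeries p ((PowerSeries.C (p : ℤ_[p]) : IwasawaAlgebra p) ^ n) =
      PowerSeries.C ((p : ℚ_[p]) ^ n) := by
    rw [map_pow, PowerSeries.map_C, map_natCast, map_pow]
  have hg₀G : g₀ = (PowerSeries.C (p : ℤ_[p]) : IwasawaAlgebra p) ^ n * G := by
    apply iwasawaToPowerSeries_injective p
    rw [hι₀, map_mul, hιC, hG]
  have hdvd : (PowerSeries.C (p : ℤ_[p]) : IwasawaAlgebra p) ^ n ∣ h * fE := ⟨G, hgh.trans hg₀G⟩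
  obtain ⟨h', hh'⟩ := (IwasawaAlgebra.prime_C p).pow_dvd_of_dvd_mul_right n hndvd hdvd
  have hpC0 : (PowerSeries.C (p : ℤ_[p]) : IwasawaAlgebra p) ^ n ≠ 0 :=
    pow_ne_zero n (IwasawaAlgebra.prime_C p).ne_zero
  have hfEh' : fE * h' = G := by
    rw [mul_comm]
    apply mul_left_cancel₀ hpC0
    rw [← hg₀G, ← hgh, hh', mul_assoc]
  -- `μ(G) = 0` from the certificate, and the `λ`-match
  have hGunit : GreenbergVatsal2000.HasUnitContent G :=
    (GreenbergVatsal2000.hasUnitContent_iff_exists_norm_coeff_map_eq_one G).mpr (hG ▸ hcert f hf)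
  have hle := hlam κ γ hκ hγ hγ' f hf D fE G hchar' hG
  have hge : (PowerSeries.map (PadicInt.toZMod (p := p)) fE).order ≤
      (PowerSeries.map (PadicInt.toZMod (p := p)) G).order := by
    rw [← hfEh', map_mul, PowerSeries.order_mul]
    exact le_self_add
  have hunit : IsUnit h' :=
    GreenbergVatsal2000.isUnit_of_mul_eq_of_order_map_eq hfEh' hGunit (le_antisymm hle hge)
  -- `char X = (fE) = (G) = (ϖ · G)`
  have hspanG : Ideal.span ({G} : Set (IwasawaAlgebra p)) = Ideal.span {fE} := by
    rw [← hfEh', mul_comm]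
    exact Ideal.span_singleton_mul_left_unit hunit fE
  set c : ℤ_[p] := ⟨(ϖ : ℚ_[p]), hϖn.le⟩ with hc_def
  have hcu : IsUnit c := PadicInt.isUnit_iff.mpr hϖn
  refine ⟨hX, PowerSeries.C c * G, ?_, ?_⟩
  · rw [hchar', ← hspanG]
    exact (Ideal.span_singleton_mul_left_unit (hcu.map PowerSeries.C) G).symm
  · rw [map_mul, hG, PowerSeries.map_C]
    rfl

/-- **The rank-1 `[T¹]`-unit discharger of the `λ`-match at any odd good ordinary prime**: at analytic
rank `1`, if `[T¹]L_p(f, α)` is a `p`-adic unit (`hcert1`) then `ord_T(G mod p) ≤ 1 ≤ ord_T(f_E)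
≤ ord_T(f_E mod p)` for every datum — Perrin-Riou–Schneider clause 1 (`T^{rank} ∣ f_E`, fact
`Schneider1985_order_charGenerator_odd`) at THE canonical height (`mazur_tate_sigma_exists_odd_holds`)
with rank `= 1` (GZK); torsion of `X` from Kato's clause (1). Class-free form of
`X9.order_le_of_rankOne_of_norm_coeff_one_eq_one`. [cite: BalakrishnanMullerStein2015, Thm. 1.7]
[cite: MazurSteinTate2006, Thm. 1.3] [cite: GreenbergVatsal2000, p. 20] [cite: Kato2004Asterisque, Thm. 17.4 (1) (p. 273)] -/
theorem OddPrime.order_le_of_rankOne_of_norm_coeff_one_eq_one (hp2 : p ≠ 2)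
    (hgood : W.HasGoodReductionAtPrime p) (hord : ¬ (p : ℤ) ∣ W.frobeniusTrace p)
    (hS : Schneider1985_order_charGenerator_odd) (hGZK : rank_eq_analyticRank_of_analyticRank_le_one)
    (hK : ∀ (κ : ZpExtension ℚ p) (γ : Field.absoluteGaloisGroup ℚ) [NeZero (W.conductorNorm ℤ)]
      (f : CuspForm (Gamma0 (W.conductorNorm ℤ)) 2), kato_divisibility W p (κ := κ) (γ := γ) (f := f))
    (hr1 : W.analyticRank = 1)
    (hcert1 : ∀ [NeZero (W.conductorNorm ℤ)] (f : CuspForm (Gamma0 (W.conductorNorm ℤ)) 2),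
      IsNewformOf W f → ‖PowerSeries.coeff 1 (padicLFunction f (unitRoot W p : ℚ_[p]))‖ = 1) :
    ∀ (κ : ZpExtension ℚ p) (γ : Field.absoluteGaloisGroup ℚ),
        κ.IsCyclotomic → κ.IsTopGenerator γ → IsCyclotomicVariable p γ →
      ∀ [NeZero (W.conductorNorm ℤ)] (f : CuspForm (Gamma0 (W.conductorNorm ℤ)) 2), IsNewformOf W f →
      ∀ (D : W.SelmerDualData κ γ) (fE G : IwasawaAlgebra p), D.charIdeal = Ideal.span {fE} →
        iwasawaToPowerSeries p G = padicLFunction f (unitRoot W p : ℚ_[p]) →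
        (PowerSeries.map (PadicInt.toZMod (p := p)) G).order ≤
          (PowerSeries.map (PadicInt.toZMod (p := p)) fE).order := by
  intro κ γ hκ hγ hγ' _ f hf D fE G hchar hG
  have h1 : ‖((PowerSeries.coeff 1 G : ℤ_[p]) : ℚ_[p])‖ = 1 := by
    have h := hcert1 f hf
    rw [← hG, PowerSeries.coeff_map] at h
    exact h
  have hu : IsUnit (PowerSeries.coeff 1 G) := PadicInt.isUnit_iff.mpr (by rwa [PadicInt.norm_def])
  have hne : PowerSeries.coeff 1 (PowerSeries.map (PadicInt.toZMod (p := p)) G) ≠ 0 := by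
    rw [PowerSeries.coeff_map]
    exact toZMod_ne_zero_of_isUnit p hu
  refine (PowerSeries.order_le 1 hne).trans ?_
  haveI : Module.Finite (IwasawaAlgebra p) D.X := D.module_finite_holds hγ
  obtain ⟨hX, -, -⟩ := hK κ γ f hp2 ⟨hgood, hord⟩ hκ hγ hγ' hf D
  obtain ⟨Dh, hDh, -⟩ :=
    existsUnique_isCanonical_of_odd mazur_tate_sigma_exists_odd_holds W p hp2 hgood hord
  obtain ⟨hS1, -, -⟩ := hS W p hp2 hgood hord κ γ hκ hγ hγ' D hX fE hchar Dh hDh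
  have hrk : W.mordellWeilRank = 1 := (hGZK W hr1.le).1.trans hr1
  rw [hrk, Nat.cast_one] at hS1
  exact le_trans hS1 (PowerSeries.le_order_map _)

/-! ### §2. Class X10b (`p = 3`, `E[3]` irreducible, `ρ̄_{E,3}` not surjective), modulo F1 -/

/-- **X10b rank-0 UNIT cell, per pair: F1 + the period unit at `3` + ONE coefficient ⟹ Mazur's INTEGRAL
main conjecture at `(E,3)`** (X_A3 at the pair; indeed `char_Λ X(E/ℚ_∞) = Λ = (L_3(E))`). Binders: F1
(`hfine`: Kato 17.4 via `X10.kato_divisibility_three_of_fine`, `μ = 0` via the X10 lane's unconditional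
kernel core `X10.mu_eq_zero_of_fine` for the non-surjective image), modularity (`hmodP`), the period unit
at `3` (`h3`, Mazur 1978 Cor. 4.1 / GV Rem. 3.4); `hX : ClassX10 W p`, `hns : ¬ Surj W 3` (the leaf
`X10.BSDpOnClassX10b`'s hypotheses); certificate `hcert0 : ‖L_3(f, α)(0)‖ = 1`. No `3`-descent datum.
[cite: Kato2004Asterisque, Thm. 12.5, 12.6 (p. 222), Thm. 17.4 (p. 273) and §17.13 (pp. 279–280)]
[cite: GreenbergVatsal2000, Prop. 3.7 and p. 20] [cite: Mazur1978, Cor. 4.1] -/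
theorem X10b.mazurMainConjecture_of_fine_of_norm_constantCoeff_eq_one
    (hfine : exists_divisibilityInputs_fineQuotient_zeta) (hmodP : nonempty_modularParametrizationData)
    (h3 : realPeriodRat_eq_unit_mul_plusPeriod_three) (hX : ClassX10 W p) (hns : ¬ Surj W 3)
    (hcert0 : ∀ [NeZero (W.conductorNorm ℤ)] (f : CuspForm (Gamma0 (W.conductorNorm ℤ)) 2),
      IsNewformOf W f → ‖PowerSeries.coeff 0 (padicLFunction f (unitRoot W p : ℚ_[p]))‖ = 1) :
    MazurMainConjecture W p := by
  obtain ⟨rfl, ⟨hgood, hord⟩, hirr, -⟩ := hX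
  have hp2 : (3 : ℕ) ≠ 2 := by decide
  haveI : NeZero (W.conductorNorm ℤ) := ⟨(W.conductorNorm_pos_holds).ne'⟩
  have hK : ∀ (κ : ZpExtension ℚ 3) (γ : Field.absoluteGaloisGroup ℚ) [NeZero (W.conductorNorm ℤ)]
      (f : CuspForm (Gamma0 (W.conductorNorm ℤ)) 2), kato_divisibility W 3 (κ := κ) (γ := γ) (f := f) :=
    fun κ γ _ f ↦ Summit.BirchSwinnertonDyer.Rank1Residual.X10.kato_divisibility_of_fine hfine W 3 κ γ
      (W.conductorNorm ℤ) f
  have hμ : ∀ (κ : ZpExtension ℚ 3) (γ : Field.absoluteGaloisGroup ℚ),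
        κ.IsCyclotomic → κ.IsTopGenerator γ → IsCyclotomicVariable 3 γ →
      ∀ (D : W.SelmerDualData κ γ), D.mu = 0 := by
    intro κ γ hκ hγ hγ' D
    obtain ⟨Dm⟩ := hmodP W
    exact Summit.BirchSwinnertonDyer.Rank1Residual.X10.mu_eq_zero_of_fine hfine W 3 Dm.f hp2 hgood hord
      hirr hns Dm.isNewformOf ⟨0, hcert0 Dm.f Dm.isNewformOf⟩ κ γ hκ hγ hγ' D
  exact OddPrime.mazurMainConjecture_of_kato_of_mu_eq_zero_of_order_le W 3 hp2 hgood hord hirr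
    (fun f hf ϖ hϖ ↦ Summit.BirchSwinnertonDyer.Rank1Residual.X10.padicValRat_periodRatio_eq_zero_three
      W h3 hgood hirr f hf ϖ hϖ)
    hK hμ (fun f hf ↦ ⟨0, hcert0 f hf⟩) (X9.order_le_of_norm_constantCoeff_eq_one W 3 hcert0)

/-- **X10b rank-0 UNIT cell, per pair: F1 + PUBLISHED facts + ONE coefficient ⟹ Miller's `BSD(E,3)`.**
`‖L_3(f, α)(0)‖ = 1` forces `L(E,1) ≠ 0` (analytic rank `0`, `constantCoeff_padicLFunction_ne_zero_iff`);
then X_A3 at the pair (above) and the cell's rank-0 skeleton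
`bsdp_of_mazurMainConjecture_of_analyticRank_eq_zero` (Greenberg Thm. 4.1 `hGr`, modularity `hmodP`,
GZK `hGZK`). No `#Ш_an` datum, no `3`-descent datum, no rational main conjecture.
[cite: Kato2004Asterisque, Thm. 12.5, 12.6 (p. 222), Thm. 17.4 (p. 273) and §17.13 (pp. 279–280)]
[cite: GreenbergLNM1716, Thm. 4.1 (p. 102)] [cite: CastellaEtAl2021, Thm. 5.1.4 and its proof (§5.1.3)]
[cite: Miller2011LMS, Def. 1.1 (arXiv:1010.2431 p. 3)] -/
theorem X10b.bsdp_of_fine_of_norm_constantCoeff_eq_one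
    (hfine : exists_divisibilityInputs_fineQuotient_zeta) (hGr : greenberg_charValue_rankZero)
    (hmodP : nonempty_modularParametrizationData) (hGZK : rank_eq_analyticRank_of_analyticRank_le_one)
    (h3 : realPeriodRat_eq_unit_mul_plusPeriod_three) (hX : ClassX10 W p) (hns : ¬ Surj W 3)
    (hcert0 : ∀ [NeZero (W.conductorNorm ℤ)] (f : CuspForm (Gamma0 (W.conductorNorm ℤ)) 2),
      IsNewformOf W f → ‖PowerSeries.coeff 0 (padicLFunction f (unitRoot W p : ℚ_[p]))‖ = 1) :
    BSDp W p := by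
  have hMC := X10b.mazurMainConjecture_of_fine_of_norm_constantCoeff_eq_one W p hfine hmodP h3 hX hns
    hcert0
  obtain ⟨rfl, ⟨hgood, hord⟩, -, -⟩ := hX
  haveI : NeZero (W.conductorNorm ℤ) := ⟨(W.conductorNorm_pos_holds).ne'⟩
  obtain ⟨Dm⟩ := hmodP W
  have hc0 : PowerSeries.constantCoeff (padicLFunction Dm.f (unitRoot W 3 : ℚ_[3])) ≠ 0 := by
    rw [← PowerSeries.coeff_zero_eq_constantCoeff_apply, ← norm_ne_zero_iff, hcert0 Dm.f Dm.isNewformOf]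
    exact one_ne_zero
  have hL : W.entireLFunction 1 ≠ 0 :=
    (constantCoeff_padicLFunction_ne_zero_iff W 3 ⟨hgood, hord⟩ Dm.isNewformOf).mp hc0
  have hr0 : W.analyticRank = 0 :=
    (W.analyticRank_eq_zero_iff_holds Dm.isNewformOf.hasEntireLFunction).mpr hL
  exact Summit.BirchSwinnertonDyer.Rank1Residual.bsdp_of_mazurMainConjecture_of_analyticRank_eq_zero hGr
    hmodP hGZK (by decide) ⟨hgood, hord⟩ hr0 hMC

/-- **X10b rank-1 `[T¹]`-unit cell, per pair: F1 + Perrin-Riou–Schneider + GZK + the period unit at `3`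
+ ONE coefficient ⟹ Mazur's INTEGRAL main conjecture at `(E,3)`.** Binders: F1 (`hfine`), `hS` (clause 1
only), `hGZK`, modularity (`hmodP`), `h3`; `hX : ClassX10 W p`, `hns : ¬ Surj W 3`; `hr1`; certificate
`hcert1 : ‖[T¹]L_3(f, α)‖ = 1`. [cite: Kato2004Asterisque, Thm. 12.5, 12.6 (p. 222), Thm. 17.4 (p. 273) and §17.13 (pp. 279–280)]
[cite: BalakrishnanMullerStein2015, Thm. 1.7] [cite: GreenbergVatsal2000, Prop. 3.7 and p. 20] -/
theorem X10b.mazurMainConjecture_rankOne_of_fine_of_norm_coeff_one_eq_one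
    (hfine : exists_divisibilityInputs_fineQuotient_zeta) (hS : Schneider1985_order_charGenerator_odd)
    (hmodP : nonempty_modularParametrizationData) (hGZK : rank_eq_analyticRank_of_analyticRank_le_one)
    (h3 : realPeriodRat_eq_unit_mul_plusPeriod_three) (hX : ClassX10 W p) (hns : ¬ Surj W 3)
    (hr1 : W.analyticRank = 1)
    (hcert1 : ∀ [NeZero (W.conductorNorm ℤ)] (f : CuspForm (Gamma0 (W.conductorNorm ℤ)) 2),
      IsNewformOf W f → ‖PowerSeries.coeff 1 (padicLFunction f (unitRoot W p : ℚ_[p]))‖ = 1) :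
    MazurMainConjecture W p := by
  obtain ⟨rfl, ⟨hgood, hord⟩, hirr, -⟩ := hX
  have hp2 : (3 : ℕ) ≠ 2 := by decide
  haveI : NeZero (W.conductorNorm ℤ) := ⟨(W.conductorNorm_pos_holds).ne'⟩
  have hK : ∀ (κ : ZpExtension ℚ 3) (γ : Field.absoluteGaloisGroup ℚ) [NeZero (W.conductorNorm ℤ)]
      (f : CuspForm (Gamma0 (W.conductorNorm ℤ)) 2), kato_divisibility W 3 (κ := κ) (γ := γ) (f := f) :=
    fun κ γ _ f ↦ Summit.BirchSwinnertonDyer.Rank1Residual.X10.kato_divisibility_of_fine hfine W 3 κ γ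
      (W.conductorNorm ℤ) f
  have hμ : ∀ (κ : ZpExtension ℚ 3) (γ : Field.absoluteGaloisGroup ℚ),
        κ.IsCyclotomic → κ.IsTopGenerator γ → IsCyclotomicVariable 3 γ →
      ∀ (D : W.SelmerDualData κ γ), D.mu = 0 := by
    intro κ γ hκ hγ hγ' D
    obtain ⟨Dm⟩ := hmodP W
    exact Summit.BirchSwinnertonDyer.Rank1Residual.X10.mu_eq_zero_of_fine hfine W 3 Dm.f hp2 hgood hord
      hirr hns Dm.isNewformOf ⟨1, hcert1 Dm.f Dm.isNewformOf⟩ κ γ hκ hγ hγ' D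
  exact OddPrime.mazurMainConjecture_of_kato_of_mu_eq_zero_of_order_le W 3 hp2 hgood hord hirr
    (fun f hf ϖ hϖ ↦ Summit.BirchSwinnertonDyer.Rank1Residual.X10.padicValRat_periodRatio_eq_zero_three
      W h3 hgood hirr f hf ϖ hϖ)
    hK hμ (fun f hf ↦ ⟨1, hcert1 f hf⟩)
    (OddPrime.order_le_of_rankOne_of_norm_coeff_one_eq_one W 3 hp2 hgood hord hS hGZK hK hr1 hcert1)

/-- **X10b rank-1 `[T¹]`-unit cell, per pair: F1 + PUBLISHED facts + ONE coefficient ⟹ Miller's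
`BSD(E,3)`.** The coefficient `[T¹]L_3(f, α) ∈ ℤ_3^×` is the `μ`-certificate, the `λ`-match and — via
Perrin-Riou's `3`-adic Gross–Zagier (`coeff_one_padicLFunction_ne_zero_iff_schneider_odd`, `hPR`) — the
Schneider certificate at THE canonical height; X_A3 at the pair then feeds the rank-1 skeleton
`bsdp_of_mazurMainConjecture_of_analyticRank_eq_one_of_schneider_odd` (`hS`, `hPR`, `hmodP`, `hGZK`;
Mazur–Tate `σ` = `mazur_tate_sigma_exists_odd_holds`). No `#Ш_an` datum, no rational main conjecture.
[cite: Kato2004Asterisque, Thm. 12.5, 12.6 (p. 222), Thm. 17.4 (p. 273) and §17.13 (pp. 279–280)]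
[cite: PerrinRiou1987, §1.4 Cor. 1.8] [cite: BalakrishnanMullerStein2015, Thm. 1.7]
[cite: Miller2011LMS, Def. 1.1 (arXiv:1010.2431 p. 3)] -/
theorem X10b.bsdp_rankOne_of_fine_of_norm_coeff_one_eq_one
    (hfine : exists_divisibilityInputs_fineQuotient_zeta) (hS : Schneider1985_order_charGenerator_odd)
    (hPR : perrinRiou_rankOne_leadingTerms_odd) (hmodP : nonempty_modularParametrizationData)
    (hGZK : rank_eq_analyticRank_of_analyticRank_le_one) (h3 : realPeriodRat_eq_unit_mul_plusPeriod_three)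
    (hX : ClassX10 W p) (hns : ¬ Surj W 3) (hr1 : W.analyticRank = 1)
    (hcert1 : ∀ [NeZero (W.conductorNorm ℤ)] (f : CuspForm (Gamma0 (W.conductorNorm ℤ)) 2),
      IsNewformOf W f → ‖PowerSeries.coeff 1 (padicLFunction f (unitRoot W p : ℚ_[p]))‖ = 1) :
    BSDp W p := by
  have hMC := X10b.mazurMainConjecture_rankOne_of_fine_of_norm_coeff_one_eq_one W p hfine hS hmodP hGZK
    h3 hX hns hr1 hcert1
  obtain ⟨rfl, ⟨hgood, hord⟩, -, -⟩ := hX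
  have hp2 : (3 : ℕ) ≠ 2 := by decide
  haveI : NeZero (W.conductorNorm ℤ) := ⟨(W.conductorNorm_pos_holds).ne'⟩
  obtain ⟨Dm⟩ := hmodP W
  have hSch : ∀ Dh : PAdicHeightData W 3, Dh.IsCanonical → SchneiderConjecture Dh := by
    intro Dh hDh
    refine (coeff_one_padicLFunction_ne_zero_iff_schneider_odd hPR hGZK W 3 hp2 ⟨hgood, hord⟩ hr1 Dh hDh
      Dm.f Dm.isNewformOf).mp ?_
    rw [← norm_ne_zero_iff, hcert1 Dm.f Dm.isNewformOf]
    exact one_ne_zero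
  exact Summit.BirchSwinnertonDyer.Rank1Residual.bsdp_of_mazurMainConjecture_of_analyticRank_eq_one_of_schneider_odd
    hS hPR mazur_tate_sigma_exists_odd_holds hmodP hGZK hp2 ⟨hgood, hord⟩ hr1 hSch hMC

end Summit.BirchSwinnertonDyer.BirchSwinnertonDyer.Rank1Residual

end
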